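import Literature.AnabelianGeometry.EtaleTheta.Discharge.Sec5Prop52InstanceForms
import Literature.AnabelianGeometry.EtaleTheta.Discharge.Sec5Prop52OfBiKummerData
import Literature.AnabelianGeometry.EtaleTheta.Discharge.Sec5Prop52iiOfConnectedTemperoid
import Literature.AnabelianGeometry.EtaleTheta.Discharge.Sec5TowerOfConnectedTemperoid
import Literature.AnabelianGeometry.EtaleTheta.Discharge.Sec5TowerOfBiKummerFamilyFacts

/-!
# [EtTh] Prop. 5.2 (ii)/(iii) p.324, §5 p.331 (PDF pp.98, 105): the rows `StrvSection` (F-0555), `ThetaPairActionsAgree` (F-0556), `ThetaPairKummerClass` (F-0558) at EVERY LEVEL of the genuine §5 towers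

Mochizuki, *The étale theta function and its Frobenioid-theoretic manifestations*, Publ. RIMS **45** (2009)
[cite: MochizukiEtTh2009, Prop 5.2 p.324 (PDF p.98); §5 p.331 (PDF p.105); Prop 4.3 (iii) p.317 (PDF p.91)].  abc-iut cell,
block F (FACT-PROVING wave, batch 2), seat abc-iut-f-126 (gen 2; tranche 126 = FACT-LIST rows **F-0555** `ThetaFrobenioid.StrvSection`,
**F-0556** `FrobenioidThetaBiKummer.ThetaPairActionsAgree`, **F-0558** `FrobenioidThetaBiKummer.ThetaPairKummerClass`, trunk
`FrobenioidThetaBiKummer.lean`).  PROOF-ONLY sequel of this seat's `Discharge/Sec5Prop52InstanceForms.lean` (p432149, abstract instance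
forms) and `Discharge/Sec5Prop52OfBiKummerData.lean` (p433476, instance forms at `ofRootData` / `ofBiKummerData` / `ofConnectedTemperoidData`):
no `def`, no `Prop` fact, no instance; nothing landed is edited or restated — every conjunct that already has a name is CITED
(abc-iut-L2-t4's `strvSection_…`, `sgpCapSpec_…` / `sgpCupSpec_…`, `biKummerDifferenceMem_levelData`; abc-iut-w6-d054's
`biKummerDifferenceMem_ofConnectedTemperoid(Ydd)Data`; abc-iut-f-125's `biKummerDifferenceMem_ofTemperoidData` (p434727);
abc-iut-w6-d086's `thetaPairActionsAgree_iff_definingRelations_of_totallyEpi` (p433092); [FrdI] Thm. 5.2 total epimorphicity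
`epi_of_model`).  The twin of abc-iut-f-125's `Discharge/Sec5SgpUniqueAtGenuineBases.lean` (F-0551–F-0554 at the same constructors).

The three rows are `parametrised` predicates on the DATA-ONLY interface `𝔉 : ThetaFrobenioid C D` (universal closures REFUTED,
abc-iut-w6-d043 `Sec5BiKummerSchemaVerdicts`; FACT-LIST rule R5: consumed at NAMED instances).  Sibling of this seat's
`Discharge/Sec5Prop52AtGenuineBases.lean` (one-level constructors `ofConnectedTemperoid(Ydd)Data` / `ofTemperoidData`; filed alongside,
independent imports).  WHAT IS NEW HERE — the rows at the TOWER levels the Thm. 5.7 / Cor. 5.12 discharges consume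
(`ThetaFrobenioidTower.ofBiKummerFamily`, `atLevel N = levelData N` by `rfl`):

* At EVERY level `N ≥ 1` of the assembled tower of roots (`ThetaFrobenioidTower.levelData N`, any bi-Kummer setting):
  `isAutAmple_AN_levelData` (`hσ`), `thetaPairActionsAgree_levelData_iff` (Prop. 5.2 (ii) as a characterisation, UNCONDITIONAL),
  `prop52Rows_levelData` = `StrvSection ∧ (A_N Aut-ample) ∧ (∀ ν, ∃ η, ThetaPairKummerClass η ν)` (inputs exactly those of
  abc-iut-L2-t4's `biKummerDifferenceMem_levelData`: `hσ`, `hH`, `hfrac`, `haut`; F-0558 in `η`-EXISTENTIAL form, witness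
  `η := ν⁻¹ ∘ (s^⊓-gp_N · (s^⊔-gp_N)⁻¹)`, `u := 1` — the PINNED `η` is NOT claimed).
* At every level of the tower over the GENUINE connected base `B^temp(Π^tp_X)⁰` (`ofConnectedTemperoidFamily.atLevel N`):
  `thetaPairActionsAgree_atLevel_ofConnectedTemperoidFamily_iff` (UNCONDITIONAL), `prop52Rows_atLevel_ofConnectedTemperoidFamily`
  (MODULO THE SINGLE PRINTED INPUT `hH`, `Π^tp_Ÿ ⊆ H_⊙`), `prop52Rows_atLevel_ofConnectedTemperoidYddTower` (`A_⊙^bs := Ÿ`: NO named input).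

HONEST FRAMING: kernel-checked consequences for data so constructed, under the printed [FrdI]/§1–§4 inputs listed as hypotheses;
nothing of [EtTh] (a refereed paper) is asserted unconditionally; a FACT row is an assumption label, not an endorsement; nothing here
bears on [IUTchIII] Cor. 3.12; no side is taken; typed ≠ proved.
-/

noncomputable section

namespace Literature.AnabelianGeometry.EtaleTheta

open CategoryTheory Opposite Literature.AlgebraicGeometry.Frobenioids Literature.AnabelianGeometry.SemiGraphs
  Literature.AnabelianGeometry.SemiGraphs.GaloisObjects Literature.AlgebraicGeometry.Frobenioids.QuasiTemperoid.BTempConnected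

universe u₀ v₀ u v w w' v' u' u''

/-! ### At every level of the assembled tower of roots (`ThetaFrobenioidTower.levelData N`, any bi-Kummer setting) -/

namespace ThetaFrobenioidTower

section LevelData

variable {K : Type u₀} [Field K] {X : SemiGraphs.TemperedArithmeticGroup.{u₀} K} {D₀ : Type u₀} [Category.{v₀} D₀]
  {V : FrdIMonoidStub.{w}} {T₀ : RealifiedDivisorMonoids (D₀ := D₀) V} {D : Type u} [Category.{v} D]
  {VD : FrdICatStub.{u, v, w} D} {S : BiKummerSetting X T₀ D VD}
  {pullFrac : ∀ {A A' : S.C} (_ : A' ⟶ A), S.biratUnits A → S.biratUnits A'}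
  {lv : ℕ+} {E : Set ℕ+} {𝒯 : ThetaEnvTower.{max v w} E} {θ : S.biratUnits S.Aodot} {Bl : S.C}
  {Pl : S.FractionPair θ Bl} {Rl : S.NthRoot θ Pl lv pullFrac}
  (h : ModelFrobenioid.Hypotheses S.tf.divisorMonoid S.tf.ratFnFunctor)
  (toB : ∀ A : S.C, S.biratUnits A →* S.tf.biratUnitsModel A) (Q : FrobenioidTheta.ThetaSubquotientStub.{w} D)
  (odd_l : Odd (lv : ℕ)) (R : ∀ N : ℕ+, S.NthRoot Rl.root Rl.pair N pullFrac) (ιX : 𝒯.PiX ≃ₜ* X.Pi)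
  (hopen : ∀ N : ℕ+, IsOpen ((S.galoisSurj (R N).AN.base (R N).αData.isGalois).ker : Set X.Pi))
  (σ : ∀ N : ℕ+, Aut (R N).AN.base →* Aut (R N).AN)
  (K' : Type w) [Field K'] (constEmb : ∀ N : ℕ+, K'ˣ →* S.tf.biratUnitsModel (R N).BN)
  (constEmb_injective : ∀ N : ℕ+, Function.Injective (constEmb N))
  (hdivc : ∀ (N : ℕ+) (g : Aut (R N).BN.base),
    ModelFrobenioid.div ((σ N ((BiKummerSetting.NthRoot.baseIso S (R N)).conjAut.symm g)).hom ≫ (R N).pair.num) =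
      ModelFrobenioid.div (R N).pair.num)
  (hdivp : ∀ (N : ℕ+) (y : 𝒯.PiYdd),
    ModelFrobenioid.div ((σ N (S.galoisSurj (R N).AN.base (R N).αData.isGalois (ιX y.1))).hom ≫ (R N).pair.den) =
      ModelFrobenioid.div (R N).pair.den)

/-- **F-0555 consequence at EVERY level `N ≥ 1` of the assembled tower**: "`A_N` is Aut-ample" from the section property of `σ N`
([FrdI] Prop. 5.6, `hσ`; abc-iut-L2-t4's `strvSection_levelData`).  [cite: MochizukiEtTh2009, §5 p.330–331 (PDF pp.104–105)] -/
theorem isAutAmple_AN_levelData (hσ : ∀ (N : ℕ+) (g : Aut (R N).AN.base), ModelFrobenioid.baseMap (σ N g).hom = g.hom)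
    (N : ℕ+) :
    (levelData h toB Q odd_l R ιX hopen σ K' constEmb constEmb_injective hdivc hdivp N).IsAutAmple
      (levelData h toB Q odd_l R ιX hopen σ K' constEmb constEmb_injective hdivc hdivp N).AN :=
  ThetaFrobenioid.isAutAmple_AN_of_strvSection _
    (strvSection_levelData h toB Q odd_l R ιX hopen σ K' constEmb constEmb_injective hdivc hdivp hσ N)

/-- **[EtTh] Prop. 5.2 (ii) (F-0556) at EVERY level `N ≥ 1` of the assembled tower, as a characterisation, UNCONDITIONAL**: the
level-`N` lifts `s^⊓-gp_N`, `s^⊔-gp_N` SATISFY their defining relations (`sgpCapSpec_levelData` / `sgpCupSpec_levelData`) and the model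
Frobenioid is totally epimorphic ([FrdI] Thm. 5.2, `epi_of_model`), so a pair of `H_{B_N}`-actions agrees with them iff it is compatible
with `s^⊓_N = (R N).pair.num`, `s^⊔_N = (R N).pair.den`.  [cite: MochizukiEtTh2009, Prop 5.2 (ii) p.324 (PDF p.98); §5 p.331 (PDF p.105)] -/
theorem thetaPairActionsAgree_levelData_iff (N : ℕ+)
    (actS actT : (levelData h toB Q odd_l R ιX hopen σ K' constEmb constEmb_injective hdivc hdivp N).HB →*
      Aut (levelData h toB Q odd_l R ιX hopen σ K' constEmb constEmb_injective hdivc hdivp N).BN) :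
    FrobenioidThetaBiKummer.ThetaPairActionsAgree
        (levelData h toB Q odd_l R ιX hopen σ K' constEmb constEmb_injective hdivc hdivp N) actS actT ↔
      (∀ hh : (levelData h toB Q odd_l R ιX hopen σ K' constEmb constEmb_injective hdivc hdivp N).HB,
          (levelData h toB Q odd_l R ιX hopen σ K' constEmb constEmb_injective hdivc hdivp N).sCap ≫ (actS hh).hom =
            ((levelData h toB Q odd_l R ιX hopen σ K' constEmb constEmb_injective hdivc hdivp N).strv
              ((levelData h toB Q odd_l R ιX hopen σ K' constEmb constEmb_injective hdivc hdivp N).autBaseIsoAB.symm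
                (hh : Aut ((levelData h toB Q odd_l R ιX hopen σ K' constEmb constEmb_injective hdivc hdivp N).base.obj
                  (levelData h toB Q odd_l R ιX hopen σ K' constEmb constEmb_injective hdivc hdivp N).BN)))).hom ≫
              (levelData h toB Q odd_l R ιX hopen σ K' constEmb constEmb_injective hdivc hdivp N).sCap) ∧
        ∀ hh : (levelData h toB Q odd_l R ιX hopen σ K' constEmb constEmb_injective hdivc hdivp N).HB,
          (levelData h toB Q odd_l R ιX hopen σ K' constEmb constEmb_injective hdivc hdivp N).sCup ≫ (actT hh).hom =
            ((levelData h toB Q odd_l R ιX hopen σ K' constEmb constEmb_injective hdivc hdivp N).strv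
              ((levelData h toB Q odd_l R ιX hopen σ K' constEmb constEmb_injective hdivc hdivp N).autBaseIsoAB.symm
                (hh : Aut ((levelData h toB Q odd_l R ιX hopen σ K' constEmb constEmb_injective hdivc hdivp N).base.obj
                  (levelData h toB Q odd_l R ιX hopen σ K' constEmb constEmb_injective hdivc hdivp N).BN)))).hom ≫
              (levelData h toB Q odd_l R ιX hopen σ K' constEmb constEmb_injective hdivc hdivp N).sCup :=
  ThetaFrobenioid.thetaPairActionsAgree_iff_definingRelations_of_totallyEpi _
    (ThetaFrobenioid.epi_of_model (DivB := S.tf.divBNatTrans) h)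
    (sgpCapSpec_levelData h toB Q odd_l R ιX hopen σ K' constEmb constEmb_injective hdivc hdivp N)
    (sgpCupSpec_levelData h toB Q odd_l R ιX hopen σ K' constEmb constEmb_injective hdivc hdivp N) actS actT

/-- **Tranche-126 certificate at EVERY level of the assembled tower**: F-0555 `StrvSection` (`hσ`), "`A_N` is Aut-ample", and F-0558 in
`η`-existential form for every `ν`; the Prop. 4.3 (iii) input is abc-iut-L2-t4's `biKummerDifferenceMem_levelData`, whose inputs are
exactly the inputs here: `hσ` ([FrdI] Prop. 5.6), `hH` (`Π^tp_Ÿ ⊆ H_⊙`, p.322), `hfrac` / `haut` (the [FrdI] Thm. 5.2 (ii) dictionary laws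
of `toB`).  [cite: MochizukiEtTh2009, Prop 5.2 p.324 (PDF p.98); §5 p.331 (PDF p.105); Prop 4.3 (iii) p.317 (PDF p.91)] -/
theorem prop52Rows_levelData
    (hσ : ∀ (N : ℕ+) (g : Aut (R N).AN.base), ModelFrobenioid.baseMap (σ N g).hom = g.hom)
    (hH : ∀ y : 𝒯.PiX, y ∈ 𝒯.PiYdd → ιX y ∈ S.Hodot)
    (hfrac : ∀ {A B : S.C} (s' s'' : A ⟶ B) (h' : S.IsPreStep s') (h'' : S.IsPreStep s'')
      (hb : PreFrobenioid.BaseEquivalent S.F s' s''),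
      (toB A (S.fracOf s' s'' h' h'' hb) : S.tf.ratFnFunctor.obj (op A.base)) * ModelFrobenioid.unit s'' =
        ModelFrobenioid.unit s')
    (haut : ∀ {A : S.C} (e : Aut A) (x : S.biratUnits A),
      (toB A (S.biratAut A e x) : S.tf.ratFnFunctor.obj (op A.base)) =
        pull S.tf.ratFnFunctor (ModelFrobenioid.baseMap e.inv) (toB A x : S.tf.ratFnFunctor.obj (op A.base)))
    (N : ℕ+) :
    (levelData h toB Q odd_l R ιX hopen σ K' constEmb constEmb_injective hdivc hdivp N).StrvSection ∧
    (levelData h toB Q odd_l R ιX hopen σ K' constEmb constEmb_injective hdivc hdivp N).IsAutAmple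
        (levelData h toB Q odd_l R ιX hopen σ K' constEmb constEmb_injective hdivc hdivp N).AN ∧
    ∀ ν : (levelData h toB Q odd_l R ιX hopen σ K' constEmb constEmb_injective hdivc hdivp N).lDeltaModN
          (levelData h toB Q odd_l R ιX hopen σ K' constEmb constEmb_injective hdivc hdivp N).BN ≃*
        (levelData h toB Q odd_l R ιX hopen σ K' constEmb constEmb_injective hdivc hdivp N).muTorsion
          (levelData h toB Q odd_l R ιX hopen σ K' constEmb constEmb_injective hdivc hdivp N).BN
          (levelData h toB Q odd_l R ιX hopen σ K' constEmb constEmb_injective hdivc hdivp N).N,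
      ∃ η : (levelData h toB Q odd_l R ιX hopen σ K' constEmb constEmb_injective hdivc hdivp N).HB →
          (levelData h toB Q odd_l R ιX hopen σ K' constEmb constEmb_injective hdivc hdivp N).lDeltaModN
            (levelData h toB Q odd_l R ιX hopen σ K' constEmb constEmb_injective hdivc hdivp N).BN,
        FrobenioidThetaBiKummer.ThetaPairKummerClass
          (levelData h toB Q odd_l R ιX hopen σ K' constEmb constEmb_injective hdivc hdivp N) η ν :=
  ⟨strvSection_levelData h toB Q odd_l R ιX hopen σ K' constEmb constEmb_injective hdivc hdivp hσ N,
    isAutAmple_AN_levelData h toB Q odd_l R ιX hopen σ K' constEmb constEmb_injective hdivc hdivp hσ N, fun ν =>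
    ThetaFrobenioid.exists_thetaPairKummerClass_of_biKummerDifferenceMem
      (biKummerDifferenceMem_levelData h toB Q odd_l R ιX hopen σ K' constEmb constEmb_injective hdivc hdivp hσ hH hfrac haut N)
      ν⟩

end LevelData

/-! ### At every level of the tower over `B^temp(Π^tp_X)⁰` (`ofConnectedTemperoidFamily`) -/

section ConnectedFamily

variable {K : Type u₀} [Field K] {X : SemiGraphs.TemperedArithmeticGroup.{u₀} K} {D₀ : Type u₀} [Category.{v₀} D₀]
  {V : FrdIMonoidStub.{w}} {T₀ : RealifiedDivisorMonoids (D₀ := D₀) V}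
  {VD : FrdICatStub.{u₀ + 1, u₀, w} (ConnectedPart (BTemp X.Pi))}
  {tf : TemperedFrobenioid T₀ (ConnectedPart (BTemp X.Pi)) VD} {hZ : tf.monoidType = MonoidType.Z}
  {hP : ∀ A : (ConnectedPart (BTemp X.Pi))ᵒᵖ, IsPerfect (tf.Φ.carrier A)}
  {NH : Subgroup (Field.absoluteGaloisGroup K) → tf.category → ℕ+ → Prop} {A₀ : tf.category}
  {hA₀ : PreFrobenioid.IsFrobeniusTrivial tf.toElem A₀} {hA₀' : SemiGraphs.IsGaloisObj A₀.base.obj}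
  {pullFrac : ∀ {A A' : (BiKummerSetting.mkOfConnectedTemperoid X tf hZ hP NH A₀ hA₀ hA₀').C} (_ : A' ⟶ A),
    (BiKummerSetting.mkOfConnectedTemperoid X tf hZ hP NH A₀ hA₀ hA₀').biratUnits A →
      (BiKummerSetting.mkOfConnectedTemperoid X tf hZ hP NH A₀ hA₀ hA₀').biratUnits A'}
  {lv : ℕ+} {E : Set ℕ+} {𝒯 : ThetaEnvTower.{max u₀ w} E}
  {θ : (BiKummerSetting.mkOfConnectedTemperoid X tf hZ hP NH A₀ hA₀ hA₀').biratUnits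
    (BiKummerSetting.mkOfConnectedTemperoid X tf hZ hP NH A₀ hA₀ hA₀').Aodot}
  {Bl : (BiKummerSetting.mkOfConnectedTemperoid X tf hZ hP NH A₀ hA₀ hA₀').C}
  {Pl : (BiKummerSetting.mkOfConnectedTemperoid X tf hZ hP NH A₀ hA₀ hA₀').FractionPair θ Bl}
  {Rl : (BiKummerSetting.mkOfConnectedTemperoid X tf hZ hP NH A₀ hA₀ hA₀').NthRoot θ Pl lv pullFrac}
  (h : ModelFrobenioid.Hypotheses tf.divisorMonoid tf.ratFnFunctor)
  (Q : FrobenioidTheta.ThetaSubquotientStub.{w} (ConnectedPart (BTemp X.Pi))) (odd_l : Odd (lv : ℕ))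
  (R : ∀ N : ℕ+, (BiKummerSetting.mkOfConnectedTemperoid X tf hZ hP NH A₀ hA₀ hA₀').NthRoot Rl.root Rl.pair N pullFrac)
  (ιX : 𝒯.PiX ≃ₜ* X.Pi) (K' : Type w) [Field K'] (constEmb : ∀ N : ℕ+, K'ˣ →* tf.biratUnitsModel (R N).BN)
  (constEmb_injective : ∀ N : ℕ+, Function.Injective (constEmb N))
  (hinvc : ∀ (N : ℕ+) (g : Aut (R N).AN.base),
    pull tf.divisorMonoid g.hom (ModelFrobenioid.div (R N).pair.num) = ModelFrobenioid.div (R N).pair.num)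
  (hinvp : ∀ (N : ℕ+) (y : 𝒯.PiX), y ∈ 𝒯.PiYdd →
    pull tf.divisorMonoid ((BiKummerSetting.mkOfConnectedTemperoid X tf hZ hP NH A₀ hA₀ hA₀').galoisSurj (R N).AN.base
      (R N).αData.isGalois (ιX y)).hom (ModelFrobenioid.div (R N).pair.den) = ModelFrobenioid.div (R N).pair.den)
  (α : ∀ {N N' : ℕ+}, (N : ℕ) ∣ N' → ((R N').AN ⟶ (R N).AN))
  (β : ∀ {N N' : ℕ+}, (N : ℕ) ∣ N' → ((R N').BN ⟶ (R N).BN))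
  (comm_sCap : ∀ {N N' : ℕ+} (hd : (N : ℕ) ∣ N'), (R N').pair.num ≫ β hd = α hd ≫ (R N).pair.num)
  (comm_sCup : ∀ {N N' : ℕ+} (hd : (N : ℕ) ∣ N'), (R N').pair.den ≫ β hd = α hd ≫ (R N).pair.den)
  (isIsometry_α : ∀ {N N' : ℕ+} (hd : (N : ℕ) ∣ N'),
    ((BiKummerSetting.mkOfConnectedTemperoid X tf hZ hP NH A₀ hA₀ hA₀').sec5Stub h).pre.IsIsometry (α hd))
  (degFr_α : ∀ {N N' : ℕ+} (hd : (N : ℕ) ∣ N'),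
    (((BiKummerSetting.mkOfConnectedTemperoid X tf hZ hP NH A₀ hA₀ hA₀').sec5Stub h).pre.degFr (α hd) : ℕ) * N = N')
  (isIsometry_β : ∀ {N N' : ℕ+} (hd : (N : ℕ) ∣ N'),
    ((BiKummerSetting.mkOfConnectedTemperoid X tf hZ hP NH A₀ hA₀ hA₀').sec5Stub h).pre.IsIsometry (β hd))
  (degFr_β : ∀ {N N' : ℕ+} (hd : (N : ℕ) ∣ N'),
    (((BiKummerSetting.mkOfConnectedTemperoid X tf hZ hP NH A₀ hA₀ hA₀').sec5Stub h).pre.degFr (β hd) : ℕ) * N = N')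
  (baseFrob_α : ∀ {N N' : ℕ+} (hd : (N : ℕ) ∣ N'),
    (BiKummerSetting.mkOfConnectedTemperoid X tf hZ hP NH A₀ hA₀ hA₀').IsOfBaseFrobeniusType (α hd))

/-- **[EtTh] Prop. 5.2 (ii) (F-0556) at EVERY level of the §5 tower over the GENUINE connected base `B^temp(Π^tp_X)⁰`, as a
characterisation, UNCONDITIONAL** (the level-`N` data of `ofConnectedTemperoidFamily` IS `levelData N` with the discharged arguments,
`atLevel_ofBiKummerFamily`).  [cite: MochizukiEtTh2009, Prop 5.2 (ii) p.324 (PDF p.98); §5 p.331 (PDF p.105)] -/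
theorem thetaPairActionsAgree_atLevel_ofConnectedTemperoidFamily_iff (N : ℕ+)
    (actS actT : ((ofConnectedTemperoidFamily h Q odd_l R ιX K' constEmb constEmb_injective hinvc hinvp α β comm_sCap comm_sCup
        isIsometry_α degFr_α isIsometry_β degFr_β baseFrob_α).atLevel N).HB →*
      Aut ((ofConnectedTemperoidFamily h Q odd_l R ιX K' constEmb constEmb_injective hinvc hinvp α β comm_sCap comm_sCup
        isIsometry_α degFr_α isIsometry_β degFr_β baseFrob_α).atLevel N).BN) :
    FrobenioidThetaBiKummer.ThetaPairActionsAgree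
        ((ofConnectedTemperoidFamily h Q odd_l R ιX K' constEmb constEmb_injective hinvc hinvp α β comm_sCap comm_sCup
          isIsometry_α degFr_α isIsometry_β degFr_β baseFrob_α).atLevel N) actS actT ↔
      (∀ hh : ((ofConnectedTemperoidFamily h Q odd_l R ιX K' constEmb constEmb_injective hinvc hinvp α β comm_sCap comm_sCup
            isIsometry_α degFr_α isIsometry_β degFr_β baseFrob_α).atLevel N).HB,
          ((ofConnectedTemperoidFamily h Q odd_l R ιX K' constEmb constEmb_injective hinvc hinvp α β comm_sCap comm_sCup
              isIsometry_α degFr_α isIsometry_β degFr_β baseFrob_α).atLevel N).sCap ≫ (actS hh).hom =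
            (((ofConnectedTemperoidFamily h Q odd_l R ιX K' constEmb constEmb_injective hinvc hinvp α β comm_sCap comm_sCup
                isIsometry_α degFr_α isIsometry_β degFr_β baseFrob_α).atLevel N).strv
              (((ofConnectedTemperoidFamily h Q odd_l R ιX K' constEmb constEmb_injective hinvc hinvp α β comm_sCap comm_sCup
                  isIsometry_α degFr_α isIsometry_β degFr_β baseFrob_α).atLevel N).autBaseIsoAB.symm
                (hh : Aut (((ofConnectedTemperoidFamily h Q odd_l R ιX K' constEmb constEmb_injective hinvc hinvp α β comm_sCap
                    comm_sCup isIsometry_α degFr_α isIsometry_β degFr_β baseFrob_α).atLevel N).base.obj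
                  ((ofConnectedTemperoidFamily h Q odd_l R ιX K' constEmb constEmb_injective hinvc hinvp α β comm_sCap comm_sCup
                    isIsometry_α degFr_α isIsometry_β degFr_β baseFrob_α).atLevel N).BN)))).hom ≫
              ((ofConnectedTemperoidFamily h Q odd_l R ιX K' constEmb constEmb_injective hinvc hinvp α β comm_sCap comm_sCup
                isIsometry_α degFr_α isIsometry_β degFr_β baseFrob_α).atLevel N).sCap) ∧
        ∀ hh : ((ofConnectedTemperoidFamily h Q odd_l R ιX K' constEmb constEmb_injective hinvc hinvp α β comm_sCap comm_sCup
            isIsometry_α degFr_α isIsometry_β degFr_β baseFrob_α).atLevel N).HB,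
          ((ofConnectedTemperoidFamily h Q odd_l R ιX K' constEmb constEmb_injective hinvc hinvp α β comm_sCap comm_sCup
              isIsometry_α degFr_α isIsometry_β degFr_β baseFrob_α).atLevel N).sCup ≫ (actT hh).hom =
            (((ofConnectedTemperoidFamily h Q odd_l R ιX K' constEmb constEmb_injective hinvc hinvp α β comm_sCap comm_sCup
                isIsometry_α degFr_α isIsometry_β degFr_β baseFrob_α).atLevel N).strv
              (((ofConnectedTemperoidFamily h Q odd_l R ιX K' constEmb constEmb_injective hinvc hinvp α β comm_sCap comm_sCup
                  isIsometry_α degFr_α isIsometry_β degFr_β baseFrob_α).atLevel N).autBaseIsoAB.symm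
                (hh : Aut (((ofConnectedTemperoidFamily h Q odd_l R ιX K' constEmb constEmb_injective hinvc hinvp α β comm_sCap
                    comm_sCup isIsometry_α degFr_α isIsometry_β degFr_β baseFrob_α).atLevel N).base.obj
                  ((ofConnectedTemperoidFamily h Q odd_l R ιX K' constEmb constEmb_injective hinvc hinvp α β comm_sCap comm_sCup
                    isIsometry_α degFr_α isIsometry_β degFr_β baseFrob_α).atLevel N).BN)))).hom ≫
              ((ofConnectedTemperoidFamily h Q odd_l R ιX K' constEmb constEmb_injective hinvc hinvp α β comm_sCap comm_sCup
                isIsometry_α degFr_α isIsometry_β degFr_β baseFrob_α).atLevel N).sCup := by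
  revert actS actT
  delta ofConnectedTemperoidFamily
  rw [atLevel_ofBiKummerFamily (K' := K') (ρ_comm_β := fun hd => rho_comm_β_of_natural R ιX
      (BiKummerSetting.mkOfConnectedTemperoid_galoisSurj_natural X tf hZ hP NH A₀ hA₀ hA₀') α β comm_sCap hd)]
  intro actS actT
  exact thetaPairActionsAgree_levelData_iff _ _ _ _ _ _ _ _ _ _ _ _ _ N actS actT

/-- **Tranche-126 certificate at EVERY level of the §5 tower over `B^temp(Π^tp_X)⁰` MODULO `hH`**: `hσ` is the theorem
`baseMap_strvOfBiKummerData`, `hfrac` / `haut` the identity-dictionary theorems `coe_fracOfModel_mul_unit` / `coe_biratAutModel_eq_pull`.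
[cite: MochizukiEtTh2009, Prop 5.2 p.324 (PDF p.98); §5 p.331 (PDF p.105); Prop 4.3 (iii) p.317 (PDF p.91)] -/
theorem prop52Rows_atLevel_ofConnectedTemperoidFamily
    (hH : ∀ y : 𝒯.PiX, y ∈ 𝒯.PiYdd → ιX y ∈ (BiKummerSetting.mkOfConnectedTemperoid X tf hZ hP NH A₀ hA₀ hA₀').Hodot) (N : ℕ+) :
    ((ofConnectedTemperoidFamily h Q odd_l R ιX K' constEmb constEmb_injective hinvc hinvp α β comm_sCap comm_sCup isIsometry_α
        degFr_α isIsometry_β degFr_β baseFrob_α).atLevel N).StrvSection ∧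
    ((ofConnectedTemperoidFamily h Q odd_l R ιX K' constEmb constEmb_injective hinvc hinvp α β comm_sCap comm_sCup isIsometry_α
        degFr_α isIsometry_β degFr_β baseFrob_α).atLevel N).IsAutAmple
      ((ofConnectedTemperoidFamily h Q odd_l R ιX K' constEmb constEmb_injective hinvc hinvp α β comm_sCap comm_sCup isIsometry_α
        degFr_α isIsometry_β degFr_β baseFrob_α).atLevel N).AN ∧
    ∀ ν : ((ofConnectedTemperoidFamily h Q odd_l R ιX K' constEmb constEmb_injective hinvc hinvp α β comm_sCap comm_sCup
            isIsometry_α degFr_α isIsometry_β degFr_β baseFrob_α).atLevel N).lDeltaModN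
          ((ofConnectedTemperoidFamily h Q odd_l R ιX K' constEmb constEmb_injective hinvc hinvp α β comm_sCap comm_sCup
            isIsometry_α degFr_α isIsometry_β degFr_β baseFrob_α).atLevel N).BN ≃*
        ((ofConnectedTemperoidFamily h Q odd_l R ιX K' constEmb constEmb_injective hinvc hinvp α β comm_sCap comm_sCup
            isIsometry_α degFr_α isIsometry_β degFr_β baseFrob_α).atLevel N).muTorsion
          ((ofConnectedTemperoidFamily h Q odd_l R ιX K' constEmb constEmb_injective hinvc hinvp α β comm_sCap comm_sCup
            isIsometry_α degFr_α isIsometry_β degFr_β baseFrob_α).atLevel N).BN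
          ((ofConnectedTemperoidFamily h Q odd_l R ιX K' constEmb constEmb_injective hinvc hinvp α β comm_sCap comm_sCup
            isIsometry_α degFr_α isIsometry_β degFr_β baseFrob_α).atLevel N).N,
      ∃ η : ((ofConnectedTemperoidFamily h Q odd_l R ιX K' constEmb constEmb_injective hinvc hinvp α β comm_sCap comm_sCup
              isIsometry_α degFr_α isIsometry_β degFr_β baseFrob_α).atLevel N).HB →
          ((ofConnectedTemperoidFamily h Q odd_l R ιX K' constEmb constEmb_injective hinvc hinvp α β comm_sCap comm_sCup
              isIsometry_α degFr_α isIsometry_β degFr_β baseFrob_α).atLevel N).lDeltaModN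
            ((ofConnectedTemperoidFamily h Q odd_l R ιX K' constEmb constEmb_injective hinvc hinvp α β comm_sCap comm_sCup
              isIsometry_α degFr_α isIsometry_β degFr_β baseFrob_α).atLevel N).BN,
        FrobenioidThetaBiKummer.ThetaPairKummerClass
          ((ofConnectedTemperoidFamily h Q odd_l R ιX K' constEmb constEmb_injective hinvc hinvp α β comm_sCap comm_sCup
            isIsometry_α degFr_α isIsometry_β degFr_β baseFrob_α).atLevel N) η ν := by
  delta ofConnectedTemperoidFamily
  rw [atLevel_ofBiKummerFamily (K' := K') (ρ_comm_β := fun hd => rho_comm_β_of_natural R ιX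
      (BiKummerSetting.mkOfConnectedTemperoid_galoisSurj_natural X tf hZ hP NH A₀ hA₀ hA₀') α β comm_sCap hd)]
  exact prop52Rows_levelData _ _ _ _ _ _ _ _ _ _ _ _ _
    (fun N g => ThetaFrobenioid.baseMap_strvOfBiKummerData h (R N) g) hH
    (fun s' s'' _ _ _ => BiKummerSetting.coe_fracOfModel_mul_unit tf T₀.isUnit_BΛ s' s'')
    (fun e x => BiKummerSetting.coe_biratAutModel_eq_pull tf e x) N

end ConnectedFamily

/-! ### At every level of the tower over `B^temp(Π^tp_X)⁰` with `A_⊙^bs := Ÿ` (`mkOfConnectedTemperoidYddTower`): NO named input -/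

section ConnectedYddTower

variable {K : Type u₀} [Field K] {X : SemiGraphs.TemperedArithmeticGroup.{u₀} K} {D₀ : Type u₀} [Category.{v₀} D₀]
  {V : FrdIMonoidStub.{w}} {T₀ : RealifiedDivisorMonoids (D₀ := D₀) V}
  {VD : FrdICatStub.{u₀ + 1, u₀, w} (ConnectedPart (BTemp X.Pi))}
  {tf : TemperedFrobenioid T₀ (ConnectedPart (BTemp X.Pi)) VD} {hZ : tf.monoidType = MonoidType.Z}
  {hP : ∀ A : (ConnectedPart (BTemp X.Pi))ᵒᵖ, IsPerfect (tf.Φ.carrier A)}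
  {NH : Subgroup (Field.absoluteGaloisGroup K) → tf.category → ℕ+ → Prop}
  {lv : ℕ+} {E : Set ℕ+} {𝒯 : ThetaEnvTower.{max u₀ w} E} {ιX : 𝒯.PiX ≃ₜ* X.Pi}
  {pullFrac : ∀ {A A' : (BiKummerSetting.mkOfConnectedTemperoidYddTower X tf hZ hP NH 𝒯 ιX).C} (_ : A' ⟶ A),
    (BiKummerSetting.mkOfConnectedTemperoidYddTower X tf hZ hP NH 𝒯 ιX).biratUnits A →
      (BiKummerSetting.mkOfConnectedTemperoidYddTower X tf hZ hP NH 𝒯 ιX).biratUnits A'}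
  {θ : (BiKummerSetting.mkOfConnectedTemperoidYddTower X tf hZ hP NH 𝒯 ιX).biratUnits
    (BiKummerSetting.mkOfConnectedTemperoidYddTower X tf hZ hP NH 𝒯 ιX).Aodot}
  {Bl : (BiKummerSetting.mkOfConnectedTemperoidYddTower X tf hZ hP NH 𝒯 ιX).C}
  {Pl : (BiKummerSetting.mkOfConnectedTemperoidYddTower X tf hZ hP NH 𝒯 ιX).FractionPair θ Bl}
  {Rl : (BiKummerSetting.mkOfConnectedTemperoidYddTower X tf hZ hP NH 𝒯 ιX).NthRoot θ Pl lv pullFrac}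
  (h : ModelFrobenioid.Hypotheses tf.divisorMonoid tf.ratFnFunctor)
  (Q : FrobenioidTheta.ThetaSubquotientStub.{w} (ConnectedPart (BTemp X.Pi))) (odd_l : Odd (lv : ℕ))
  (R : ∀ N : ℕ+, (BiKummerSetting.mkOfConnectedTemperoidYddTower X tf hZ hP NH 𝒯 ιX).NthRoot Rl.root Rl.pair N pullFrac)
  (K' : Type w) [Field K'] (constEmb : ∀ N : ℕ+, K'ˣ →* tf.biratUnitsModel (R N).BN)
  (constEmb_injective : ∀ N : ℕ+, Function.Injective (constEmb N))
  (hinvc : ∀ (N : ℕ+) (g : Aut (R N).AN.base),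
    pull tf.divisorMonoid g.hom (ModelFrobenioid.div (R N).pair.num) = ModelFrobenioid.div (R N).pair.num)
  (hinvp : ∀ (N : ℕ+) (y : 𝒯.PiX), y ∈ 𝒯.PiYdd →
    pull tf.divisorMonoid ((BiKummerSetting.mkOfConnectedTemperoidYddTower X tf hZ hP NH 𝒯 ιX).galoisSurj (R N).AN.base
      (R N).αData.isGalois (ιX y)).hom (ModelFrobenioid.div (R N).pair.den) = ModelFrobenioid.div (R N).pair.den)
  (α : ∀ {N N' : ℕ+}, (N : ℕ) ∣ N' → ((R N').AN ⟶ (R N).AN))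
  (β : ∀ {N N' : ℕ+}, (N : ℕ) ∣ N' → ((R N').BN ⟶ (R N).BN))
  (comm_sCap : ∀ {N N' : ℕ+} (hd : (N : ℕ) ∣ N'), (R N').pair.num ≫ β hd = α hd ≫ (R N).pair.num)
  (comm_sCup : ∀ {N N' : ℕ+} (hd : (N : ℕ) ∣ N'), (R N').pair.den ≫ β hd = α hd ≫ (R N).pair.den)
  (isIsometry_α : ∀ {N N' : ℕ+} (hd : (N : ℕ) ∣ N'),
    ((BiKummerSetting.mkOfConnectedTemperoidYddTower X tf hZ hP NH 𝒯 ιX).sec5Stub h).pre.IsIsometry (α hd))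
  (degFr_α : ∀ {N N' : ℕ+} (hd : (N : ℕ) ∣ N'),
    (((BiKummerSetting.mkOfConnectedTemperoidYddTower X tf hZ hP NH 𝒯 ιX).sec5Stub h).pre.degFr (α hd) : ℕ) * N = N')
  (isIsometry_β : ∀ {N N' : ℕ+} (hd : (N : ℕ) ∣ N'),
    ((BiKummerSetting.mkOfConnectedTemperoidYddTower X tf hZ hP NH 𝒯 ιX).sec5Stub h).pre.IsIsometry (β hd))
  (degFr_β : ∀ {N N' : ℕ+} (hd : (N : ℕ) ∣ N'),
    (((BiKummerSetting.mkOfConnectedTemperoidYddTower X tf hZ hP NH 𝒯 ιX).sec5Stub h).pre.degFr (β hd) : ℕ) * N = N')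
  (baseFrob_α : ∀ {N N' : ℕ+} (hd : (N : ℕ) ∣ N'),
    (BiKummerSetting.mkOfConnectedTemperoidYddTower X tf hZ hP NH 𝒯 ιX).IsOfBaseFrobeniusType (α hd))

/-- **Tranche-126 certificate at EVERY level of the §5 tower over `B^temp(Π^tp_X)⁰` with `A_⊙^bs := Ÿ`, NO named input**
(`hH := hH_mkOfConnectedTemperoidYddTower`, abc-iut-L2-t4's theorem): F-0555 `StrvSection`, "`A_N` is Aut-ample" and F-0558 (`η`-existential,
every `ν`) are THEOREMS of the construction data at every level `N ≥ 1`.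
[cite: MochizukiEtTh2009, Prop 5.2 p.324 (PDF p.98); §5 p.331 (PDF p.105); Prop 4.3 (iii) p.317 (PDF p.91)] -/
theorem prop52Rows_atLevel_ofConnectedTemperoidYddTower (N : ℕ+) :
    ((ofConnectedTemperoidFamily h Q odd_l R ιX K' constEmb constEmb_injective hinvc hinvp α β comm_sCap comm_sCup isIsometry_α
        degFr_α isIsometry_β degFr_β baseFrob_α).atLevel N).StrvSection ∧
    ((ofConnectedTemperoidFamily h Q odd_l R ιX K' constEmb constEmb_injective hinvc hinvp α β comm_sCap comm_sCup isIsometry_α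
        degFr_α isIsometry_β degFr_β baseFrob_α).atLevel N).IsAutAmple
      ((ofConnectedTemperoidFamily h Q odd_l R ιX K' constEmb constEmb_injective hinvc hinvp α β comm_sCap comm_sCup isIsometry_α
        degFr_α isIsometry_β degFr_β baseFrob_α).atLevel N).AN ∧
    ∀ ν : ((ofConnectedTemperoidFamily h Q odd_l R ιX K' constEmb constEmb_injective hinvc hinvp α β comm_sCap comm_sCup
            isIsometry_α degFr_α isIsometry_β degFr_β baseFrob_α).atLevel N).lDeltaModN
          ((ofConnectedTemperoidFamily h Q odd_l R ιX K' constEmb constEmb_injective hinvc hinvp α β comm_sCap comm_sCup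
            isIsometry_α degFr_α isIsometry_β degFr_β baseFrob_α).atLevel N).BN ≃*
        ((ofConnectedTemperoidFamily h Q odd_l R ιX K' constEmb constEmb_injective hinvc hinvp α β comm_sCap comm_sCup
            isIsometry_α degFr_α isIsometry_β degFr_β baseFrob_α).atLevel N).muTorsion
          ((ofConnectedTemperoidFamily h Q odd_l R ιX K' constEmb constEmb_injective hinvc hinvp α β comm_sCap comm_sCup
            isIsometry_α degFr_α isIsometry_β degFr_β baseFrob_α).atLevel N).BN
          ((ofConnectedTemperoidFamily h Q odd_l R ιX K' constEmb constEmb_injective hinvc hinvp α β comm_sCap comm_sCup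
            isIsometry_α degFr_α isIsometry_β degFr_β baseFrob_α).atLevel N).N,
      ∃ η : ((ofConnectedTemperoidFamily h Q odd_l R ιX K' constEmb constEmb_injective hinvc hinvp α β comm_sCap comm_sCup
              isIsometry_α degFr_α isIsometry_β degFr_β baseFrob_α).atLevel N).HB →
          ((ofConnectedTemperoidFamily h Q odd_l R ιX K' constEmb constEmb_injective hinvc hinvp α β comm_sCap comm_sCup
              isIsometry_α degFr_α isIsometry_β degFr_β baseFrob_α).atLevel N).lDeltaModN
            ((ofConnectedTemperoidFamily h Q odd_l R ιX K' constEmb constEmb_injective hinvc hinvp α β comm_sCap comm_sCup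
              isIsometry_α degFr_α isIsometry_β degFr_β baseFrob_α).atLevel N).BN,
        FrobenioidThetaBiKummer.ThetaPairKummerClass
          ((ofConnectedTemperoidFamily h Q odd_l R ιX K' constEmb constEmb_injective hinvc hinvp α β comm_sCap comm_sCup
            isIsometry_α degFr_α isIsometry_β degFr_β baseFrob_α).atLevel N) η ν :=
  prop52Rows_atLevel_ofConnectedTemperoidFamily h Q odd_l R ιX K' constEmb constEmb_injective hinvc hinvp α β comm_sCap comm_sCup
    isIsometry_α degFr_α isIsometry_β degFr_β baseFrob_α (BiKummerSetting.hH_mkOfConnectedTemperoidYddTower X tf hZ hP NH 𝒯 ιX) N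

end ConnectedYddTower

end ThetaFrobenioidTower

end Literature.AnabelianGeometry.EtaleTheta

end
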